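import Summits.Ventures.CertifiedManyBodySolver.Observables.SourcedGibbsTrialCapSqPair
import Literature.LinearAlgebra.Matrix.HermitianMatrixFunctionEigenvector
import HarnessLib

/-!
# The AF–BCS sourced cap in momentum space (XV-b): the Fermi FUNCTIONAL CALCULUS on square-eigenvectors and
# square-closed pairs

Cell hubbard-obs (seat hubbard-obs-pin-2). HONEST FRAMING: zero compute; matrix-analysis lemmas towards the uniform-in-`L`
packaging of the certified AF–BCS cap (`AF-TL-PACKAGING.md` of the cell deposit, step 2). Files (IX)/(XI) evaluated the
Fermi MATRIX `(1 + e^{βA})⁻¹` on vectors `u` with `A²u = E²u` and on square-closed pairs; the thermodynamic-limit step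
needs the same evaluation rules for the functional calculus `cfc f_β A`, `f_β(x) = (1 − tanh(βx/2))/2` — the object to
which the Hilbert–Schmidt Lipschitz bound (`Literature/LinearAlgebra/Matrix/HermitianMatrixFunctionLipschitz`) applies.
No number is claimed; not a statement about order; not a superconductivity verdict.

* `cfc_fermi_mulVec_of_sq_eigen` — `A²u = E²u`, `E ≥ 0` ⇒ `f_β(A)u = ½u − (tanh(βE/2)/(2E))·Au`;
* `cfc_fermi_mulVec_of_sq_pair` — the square-closed-pair formula of `fermi_mulVec_of_sq_pair`, for `cfc f_β A`.

References: von Delft–Ralph (2001) §4.2 [VondelftRalph2001]; Bach–Lieb–Solovej (1994) §2 [BachLiebSolovej1994];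
Horn–Johnson (2012) Theorem 1.1.6 [HornJohnson2012].
-/

noncomputable section

open Matrix Finset
open scoped ComplexConjugate ComplexOrder

namespace Summit.Ventures.CertifiedManyBodySolver.Observables

section CfcSqPair

variable {n : Type*} [Fintype n] [DecidableEq n]

/-- **The Fermi functional calculus on a square-eigenvector.** If `A` is Hermitian, `A(Au) = E²u` and `E ≥ 0`, then
`f_β(A)u = ½u − (tanh(βE/2)/(2E))·Au` for `f_β(x) = (1 − tanh(βx/2))/2` (`cfc`); at `E = 0` the formula reads `½u`
(`Au = 0`, and Lean's `x/0 = 0`). [cite: VondelftRalph2001, §4.2] [cite: HornJohnson2012, Theorem 1.1.6] -/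
theorem cfc_fermi_mulVec_of_sq_eigen {A : Matrix n n ℂ} (hA : A.IsHermitian) (β : ℝ) {u : n → ℂ} {E : ℝ}
    (hE : 0 ≤ E) (hu : A *ᵥ (A *ᵥ u) = ((E ^ 2 : ℝ) : ℂ) • u) :
    cfc (fun x : ℝ => (1 - Real.tanh (β * x / 2)) / 2) A *ᵥ u =
      ((1 / 2 : ℝ) : ℂ) • u - ((Real.tanh (β * E / 2) / (2 * E) : ℝ) : ℂ) • (A *ᵥ u) := by
  rcases eq_or_lt_of_le hE with hE0 | hEpos
  · -- `E = 0`: `Au = 0`, `u` is an eigenvector for `0`, `f_β(0) = ½`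
    subst hE0
    have hu0 : A *ᵥ (A *ᵥ u) = 0 := by rw [hu]; simp
    have hAu : A *ᵥ u = 0 := mulVec_eq_zero_of_mulVec_mulVec_eq_zero hA hu0
    have heig : A *ᵥ u = ((0 : ℝ) : ℂ) • u := by rw [hAu]; simp
    rw [Literature.LinearAlgebra.Matrix.cfc_mulVec_of_mulVec_eq_smul hA _ heig, hAu, smul_zero, sub_zero]
    norm_num
  · rw [Literature.LinearAlgebra.Matrix.cfc_mulVec_of_sq_eigen hA _ hEpos.ne' hu]
    have h1 : ((1 - Real.tanh (β * E / 2)) / 2 + (1 - Real.tanh (β * -E / 2)) / 2) / 2 = 1 / 2 := by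
      rw [show β * -E / 2 = -(β * E / 2) by ring, Real.tanh_neg]; ring
    have h2 : ((1 - Real.tanh (β * E / 2)) / 2 - (1 - Real.tanh (β * -E / 2)) / 2) / (2 * E) =
        -(Real.tanh (β * E / 2) / (2 * E)) := by
      rw [show β * -E / 2 = -(β * E / 2) by ring, Real.tanh_neg]; ring
    rw [h1, h2]
    push_cast
    rw [neg_smul, sub_eq_add_neg]

/-- **The Fermi functional calculus on a square-closed pair** — the `cfc` form of `fermi_mulVec_of_sq_pair`: for
Hermitian `A` with `A²v = a v + b w`, `A²w = b v + a' w`, `a + a' ≥ 0`, `b² ≤ a a'`, and `f_β(x) = (1 − tanh(βx/2))/2`,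
`f_β(A) v = ½·v − Q(E₊)·(A v₊) − Q(E₋)·(A v₋)` with `E_± = √(m ± r)`, `m = (a + a')/2`, `r = √(((a − a')/2)² + b²)`,
`Q(E) = tanh(βE/2)/(2E)`, `v_± = ½v ± (A²v − m v)/(2r)`. [cite: VondelftRalph2001, §4.2] [cite: BachLiebSolovej1994, §2] -/
theorem cfc_fermi_mulVec_of_sq_pair {A : Matrix n n ℂ} (hA : A.IsHermitian) {v w : n → ℂ} (β : ℝ) {a a' b : ℝ}
    (hv : A *ᵥ (A *ᵥ v) = (a : ℂ) • v + (b : ℂ) • w) (hw : A *ᵥ (A *ᵥ w) = (b : ℂ) • v + (a' : ℂ) • w)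
    (hsum : 0 ≤ a + a') (hdet : b ^ 2 ≤ a * a') :
    cfc (fun x : ℝ => (1 - Real.tanh (β * x / 2)) / 2) A *ᵥ v =
      ((1 / 2 : ℝ) : ℂ) • v -
        ((Real.tanh (β * Real.sqrt ((a + a') / 2 + Real.sqrt (((a - a') / 2) ^ 2 + b ^ 2)) / 2) /
            (2 * Real.sqrt ((a + a') / 2 + Real.sqrt (((a - a') / 2) ^ 2 + b ^ 2))) : ℝ) : ℂ) •
          (A *ᵥ (((1 / 2 : ℝ) : ℂ) • v +
            ((1 / (2 * Real.sqrt (((a - a') / 2) ^ 2 + b ^ 2)) : ℝ) : ℂ) •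
              (A *ᵥ (A *ᵥ v) - (((a + a') / 2 : ℝ) : ℂ) • v))) -
        ((Real.tanh (β * Real.sqrt ((a + a') / 2 - Real.sqrt (((a - a') / 2) ^ 2 + b ^ 2)) / 2) /
            (2 * Real.sqrt ((a + a') / 2 - Real.sqrt (((a - a') / 2) ^ 2 + b ^ 2))) : ℝ) : ℂ) •
          (A *ᵥ (((1 / 2 : ℝ) : ℂ) • v -
            ((1 / (2 * Real.sqrt (((a - a') / 2) ^ 2 + b ^ 2)) : ℝ) : ℂ) •
              (A *ᵥ (A *ᵥ v) - (((a + a') / 2 : ℝ) : ℂ) • v))) := by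
  set r := Real.sqrt (((a - a') / 2) ^ 2 + b ^ 2) with hr
  set m := (a + a') / 2 with hm
  have hr2 : r ^ 2 = ((a - a') / 2) ^ 2 + b ^ 2 := Real.sq_sqrt (by positivity)
  have hr0 : 0 ≤ r := Real.sqrt_nonneg _
  have hm2 : r ^ 2 ≤ m ^ 2 := by rw [hr2, hm]; nlinarith
  have hmr : r ≤ m := by
    have hm0 : 0 ≤ m := by rw [hm]; linarith
    nlinarith
  have hlp : 0 ≤ m + r := by linarith
  have hlm : 0 ≤ m - r := by linarith
  set vp := ((1 / 2 : ℝ) : ℂ) • v + ((1 / (2 * r) : ℝ) : ℂ) • (A *ᵥ (A *ᵥ v) - ((m : ℝ) : ℂ) • v) with hvp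
  set vm := ((1 / 2 : ℝ) : ℂ) • v - ((1 / (2 * r) : ℝ) : ℂ) • (A *ᵥ (A *ᵥ v) - ((m : ℝ) : ℂ) • v) with hvm
  have hdecomp : v = vp + vm := by
    rw [hvp, hvm]; ext i; simp only [Pi.add_apply, Pi.smul_apply, Pi.sub_apply, smul_eq_mul]; push_cast; ring
  have hsqp : A *ᵥ (A *ᵥ vp) = (((Real.sqrt (m + r)) ^ 2 : ℝ) : ℂ) • vp := by
    rw [Real.sq_sqrt hlp, hvp]; exact sq_eigen_of_sq_pair_plus hv hw
  have hsqm : A *ᵥ (A *ᵥ vm) = (((Real.sqrt (m - r)) ^ 2 : ℝ) : ℂ) • vm := by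
    rw [Real.sq_sqrt hlm, hvm]; exact sq_eigen_of_sq_pair_minus hv hw
  have hp := cfc_fermi_mulVec_of_sq_eigen hA β (Real.sqrt_nonneg (m + r)) hsqp
  have hmi := cfc_fermi_mulVec_of_sq_eigen hA β (Real.sqrt_nonneg (m - r)) hsqm
  conv_lhs => rw [hdecomp, Matrix.mulVec_add, hp, hmi]
  rw [hvp, hvm]
  ext i
  simp only [Pi.add_apply, Pi.smul_apply, Pi.sub_apply, smul_eq_mul]
  push_cast
  ring

end CfcSqPair

end Summit.Ventures.CertifiedManyBodySolver.Observables
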